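import Summits.BirchSwinnertonDyer.BirchSwinnertonDyer.Theorems.ByReductionTypeAtTwoGoodOrdTowerCoinvDevissage
import HarnessLib

/-!
# Route `ByReductionTypeAtTwo`, item `OrdKatoHalfAtTwo` (stmt-BirchSwinnertonDyer-19271), TOWER road, the
# GOOD-ORDINARY local tower kernels at `v ∣ 2` at FULL `2`-power depth: BRICK A′ — dévissage of the `m`-torsion of
# coinvariants along the reduction map, counted against the (finite) IMAGE of the reduction

HONEST FRAMING (cell `bsd-2adic`, run/shared/lean/pub/bsd-2adic/, seat `bsd-2adic-tower-1` GEN 20, HUMAN RULINGS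
D-0036 / D-0054 / D-0074): TOOL theorem only (pure algebra; no definition, no named fact, no `sorry`); closes nothing
by itself; nothing booked; BSD is not proved by any of this. First brick of the programme «UNIFORM layer bound
`∃ C, ∀ n, #𝒦_{v,n}[2^∞] ≤ C` at a good ordinary `2` over `ℚ`» ⇒ `WeierstrassCurve.Greenberg1999_kerG_bounded` at `p = 2`
⇒ Mazur's control theorem `WeierstrassCurve.selmer_control` over `ℚ` at `p = 2` (Greenberg, LNM 1716, Thm. 1.2, via the
tree's `Greenberg1999_kerG_bounded_of_atP_layerBounds` / `selmer_control_of_kerG_bounded`). It is the depth-`2^k`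
companion of GEN 11's BRICK G1 `natCard_torsionBy_quotient_le_of_invariant` (`…GoodOrdTowerCoinvDevissage.lean`): there
the second factor is the `m`-torsion of the reduction TARGET `T = Ẽ(k̄_v)` — of order `2^k` at `m = 2^k`, useless for a
bound uniform in `k` — here it is the IMAGE `r(M)` of the reduction on the `H_∞`-fixed points, which lies in the finite
`Ẽ(𝔽₂)` (the cyclotomic `ℤ₂`-tower is totally ramified at `2`) and does not depend on `k`.

* `natCard_torsionBy_quotient_le_mul_card_range` — for an additive group `M` with an endomorphism `D` («`g − 1`»), an
  additive `r : M → T` with `r ∘ D = 0` and FINITE image, such that every value `r x` is attained on an element killed by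
  `D` (Hensel lifts to `g`-fixed points), and an injective `j : M₁ ↪ M` whose image contains `ker r`, intertwining an
  endomorphism `D₁` of `M₁` with `D`: for every `m : ℕ`, `#(M/D M)[m] ≤ #(M₁/D₁ M₁)[m] · #r(M)` (with finiteness).
  Proof = BRICK G1's with `r̄(P) ⊆ r(M)` in place of `r̄(P) ⊆ T[m]`.

References: R. Greenberg, LNM 1716 (1999), §3 Lemma 3.4 (p. 89) with Prop. 2.5 (p. 80) (the extension
`0 → ker a_{v_n} → ker r_{v_n} → ker b_{v_n} → 0`); J.-P. Serre, *Local Fields*, XIII §1.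
-/

set_option autoImplicit false
-- the Theorems namespace of this sub repeats the summit name by design (D-0017 nested layout: Summit.<S>.<Sub>)
set_option linter.dupNamespace false

noncomputable section

open scoped Classical

universe u v

namespace Summit.BirchSwinnertonDyer.BirchSwinnertonDyer.Theorems.GoodOrdTower

variable {M : Type u} {M₁ : Type u} {T : Type v} [AddCommGroup M] [AddCommGroup M₁] [AddCommGroup T]

/-- **Dévissage of the `m`-torsion of coinvariants along an invariant map with invariant lifts and FINITE IMAGE.** Let
`M` be an additive group with an endomorphism `D` («`g − 1`»), `r : M → T` additive with `r ∘ D = 0`, finite image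
`r(M)`, and such that every `x` has an `x₀` with `D x₀ = 0` and `r x₀ = r x` («invariant lifts»); let `j : M₁ ↪ M` be an
injective additive map whose image contains `ker r` and `D₁` an endomorphism of `M₁` with `j ∘ D₁ = D ∘ j`. If the
`m`-torsion of `M₁/D₁ M₁` is finite, then the `m`-torsion of `M/D M` is finite and
`#(M/D M)[m] ≤ #(M₁/D₁ M₁)[m] · #r(M)` (any `m : ℕ`). As in BRICK G1: `r` descends to `r̄ : M/DM → T`; on the
`m`-torsion subgroup `P` of `M/DM`, `#P = #r̄(P) · #(P ∩ ker r̄)` with `r̄(P) ⊆ r(M)`, and a class `[x] ∈ P ∩ ker r̄` is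
the image of an `m`-torsion class of `M₁/D₁ M₁`. [cite: GreenbergLNM1716, §3 Lemma 3.4 (proof, p. 89)] -/
theorem natCard_torsionBy_quotient_le_mul_card_range (D : M →+ M) (r : M →+ T) (hrD : ∀ x, r (D x) = 0)
    [Finite r.range] (hlift : ∀ x : M, ∃ x₀ : M, D x₀ = 0 ∧ r x₀ = r x)
    (j : M₁ →+ M) (hj : Function.Injective j) (hrj : ∀ y, r y = 0 → ∃ x, j x = y)
    (D₁ : M₁ →+ M₁) (hD₁ : ∀ x, j (D₁ x) = D (j x)) (m : ℕ)
    [Finite {c : M₁ ⧸ D₁.range // m • c = 0}] :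
    Finite {c : M ⧸ D.range // m • c = 0} ∧
      Nat.card {c : M ⧸ D.range // m • c = 0} ≤
        Nat.card {c : M₁ ⧸ D₁.range // m • c = 0} * Nat.card r.range := by
  -- notation
  let Q := M ⧸ D.range
  let Q₁ := M₁ ⧸ D₁.range
  -- `r` descends to `r̄ : M/DM → T`
  have hle : D.range ≤ r.ker := by
    rintro _ ⟨x, rfl⟩
    exact (AddMonoidHom.mem_ker).mpr (hrD x)
  let rbar : Q →+ T := QuotientAddGroup.lift D.range r hle
  have hrbar : ∀ x : M, rbar (QuotientAddGroup.mk x) = r x := fun x ↦ QuotientAddGroup.lift_mk' _ _ x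
  -- the map `M₁/D₁M₁ → M/DM` induced by `j`
  have hle₁ : D₁.range ≤ D.range.comap j := by
    rintro _ ⟨x, rfl⟩
    exact ⟨j x, (hD₁ x).symm⟩
  let ι : Q₁ →+ Q := QuotientAddGroup.map D₁.range D.range j hle₁
  have hι : ∀ x : M₁, ι (QuotientAddGroup.mk x) = QuotientAddGroup.mk (j x) := fun x ↦
    QuotientAddGroup.map_mk' _ _ _ _ x
  -- the `m`-torsion subgroups
  let P : AddSubgroup Q := AddSubgroup.torsionBy Q (m : ℤ)
  have hP : ∀ c : Q, c ∈ P ↔ m • c = 0 := fun c ↦ AddSubgroup.torsionBy.nsmul_iff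
  let P₁ : AddSubgroup Q₁ := AddSubgroup.torsionBy Q₁ (m : ℤ)
  have hP₁ : ∀ c : Q₁, c ∈ P₁ ↔ m • c = 0 := fun c ↦ AddSubgroup.torsionBy.nsmul_iff
  haveI hP₁fin : Finite P₁ :=
    Finite.of_equiv _ (Equiv.subtypeEquivRight fun c ↦ (hP₁ c).symm)
  -- `φ = r̄|_P : P → T`; `#P = #range φ · #ker φ`
  let φ : P →+ T := rbar.comp P.subtype
  have hdec : Nat.card P = Nat.card (P ⧸ φ.ker) * Nat.card φ.ker :=
    AddSubgroup.card_eq_card_quotient_mul_card_addSubgroup _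
  have hq : Nat.card (P ⧸ φ.ker) = Nat.card φ.range :=
    Nat.card_congr (QuotientAddGroup.quotientKerEquivRange φ).toEquiv
  -- `range φ ⊆ r(M)`
  have hrange_le : φ.range ≤ r.range := by
    rintro _ ⟨c, rfl⟩
    obtain ⟨x, hx⟩ := QuotientAddGroup.mk_surjective ((c : P) : Q)
    refine ⟨x, ?_⟩
    change r x = rbar ((c : P) : Q)
    rw [← hx, hrbar]
  haveI hrange_fin : Finite φ.range := Finite.of_injective _ (AddSubgroup.inclusion_injective hrange_le)
  have hrange : Nat.card φ.range ≤ Nat.card r.range := AddSubgroup.card_le_of_le hrange_le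
  -- `ker φ ↪ (M₁/D₁M₁)[m]`: a class `[x]` with `m[x] = 0`, `r x = 0` is the image of an `m`-torsion class of `M₁/D₁M₁`
  have hker_mem : ∀ k : φ.ker, ∃ x : M₁, ι (QuotientAddGroup.mk x) = ((k : P) : Q) ∧
      (QuotientAddGroup.mk x : Q₁) ∈ P₁ := by
    intro k
    obtain ⟨x, hx⟩ := QuotientAddGroup.mk_surjective ((k : P) : Q)
    have hk0 : φ k = 0 := k.2
    have hrx : r x = 0 := by
      change rbar ((k : P) : Q) = 0 at hk0
      rw [← hx, hrbar] at hk0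
      exact hk0
    obtain ⟨x₁, rfl⟩ := hrj x hrx
    have hpx : (m • QuotientAddGroup.mk (j x₁) : Q) = 0 := by rw [hx]; exact (hP _).mp (k : P).2
    rw [← QuotientAddGroup.mk_nsmul, QuotientAddGroup.eq_zero_iff] at hpx
    obtain ⟨y, hy⟩ := hpx
    obtain ⟨y₀, hDy₀, hry₀⟩ := hlift y
    obtain ⟨y₁, hy₁⟩ := hrj (y - y₀) (by rw [map_sub, hry₀, sub_self])
    refine ⟨x₁, by rw [hι, hx], ?_⟩
    rw [hP₁, ← QuotientAddGroup.mk_nsmul, QuotientAddGroup.eq_zero_iff]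
    refine ⟨y₁, hj ?_⟩
    rw [hD₁, hy₁, map_sub, hDy₀, sub_zero, hy, map_nsmul]
  let ψ : φ.ker → P₁ := fun k ↦ ⟨QuotientAddGroup.mk (hker_mem k).choose, (hker_mem k).choose_spec.2⟩
  have hψ : Function.Injective ψ := by
    intro k k' h
    have h1 : (QuotientAddGroup.mk (hker_mem k).choose : Q₁) = QuotientAddGroup.mk (hker_mem k').choose :=
      congrArg Subtype.val h
    have h2 : ((k : P) : Q) = ((k' : P) : Q) := by
      rw [← (hker_mem k).choose_spec.1, ← (hker_mem k').choose_spec.1, h1]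
    exact Subtype.ext (Subtype.ext h2)
  haveI hker_fin : Finite φ.ker := Finite.of_injective ψ hψ
  have hker : Nat.card φ.ker ≤ Nat.card P₁ := Nat.card_le_card_of_injective ψ hψ
  -- finiteness of `P` and the count
  have hPcard : Nat.card P = Nat.card φ.range * Nat.card φ.ker := by rw [hdec, hq]
  haveI hPfin : Finite P := by
    apply Nat.finite_of_card_ne_zero
    rw [hPcard]
    exact mul_ne_zero (Nat.card_pos (α := φ.range)).ne' (Nat.card_pos (α := φ.ker)).ne'
  have e : Nat.card {c : Q // m • c = 0} = Nat.card P :=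
    Nat.card_congr (Equiv.subtypeEquivRight fun c ↦ (hP c).symm)
  have e₁ : Nat.card {c : Q₁ // m • c = 0} = Nat.card P₁ :=
    Nat.card_congr (Equiv.subtypeEquivRight fun c ↦ (hP₁ c).symm)
  refine ⟨Finite.of_equiv _ (Equiv.subtypeEquivRight fun c ↦ hP c), ?_⟩
  rw [e, e₁, hPcard, mul_comm]
  exact Nat.mul_le_mul hker hrange

/-- **A `p`-primary torsion group whose `p^k`-torsion is uniformly bounded is finite, with the same bound.** If every
element of an additive group `A` is killed by a power of `p` and `#A[p^k] ≤ B` for every `k` (each `A[p^k]` finite), then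
`A` is finite with `#A ≤ B`: any finite subset of `A` lies in one `A[p^k]`. Used to pass from the depth-`2^k` bounds on the
local tower kernels `𝒦_{v,n}[2^∞][2^k]` to a bound on `𝒦_{v,n}[2^∞]` itself. [folklore] -/
theorem finite_and_natCard_le_of_forall_torsionBy_le {A : Type u} [AddCommGroup A] (p : ℕ)
    (hprim : ∀ a : A, ∃ k : ℕ, p ^ k • a = 0) {B : ℕ}
    (hfin : ∀ k : ℕ, Finite {a : A // p ^ k • a = 0})
    (hB : ∀ k : ℕ, Nat.card {a : A // p ^ k • a = 0} ≤ B) :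
    Finite A ∧ Nat.card A ≤ B := by
  -- every finite subset of `A` has at most `B` elements
  have hsub : ∀ s : Finset A, s.card ≤ B := by
    intro s
    -- a common exponent
    choose k hk using hprim
    let K : ℕ := s.sup k
    have hK : ∀ a ∈ s, p ^ K • a = 0 := fun a ha ↦ by
      obtain ⟨d, hd⟩ := Nat.exists_eq_add_of_le (Finset.le_sup (f := k) ha)
      change p ^ (s.sup k) • a = 0
      rw [hd, pow_add, mul_comm, mul_smul, hk a, smul_zero]
    haveI := hfin K
    let ι : s → {a : A // p ^ K • a = 0} := fun a ↦ ⟨a.1, hK a.1 a.2⟩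
    have hι : Function.Injective ι := fun a b h ↦ Subtype.ext (congrArg (fun x : {a : A // p ^ K • a = 0} ↦ x.1) h)
    have h := Nat.card_le_card_of_injective ι hι
    rw [Nat.card_eq_fintype_card, Fintype.card_coe] at h
    exact h.trans (hB K)
  -- hence `A` is finite
  haveI : Finite A := by
    by_contra hinf
    rw [not_finite_iff_infinite] at hinf
    obtain ⟨s, hs⟩ := Infinite.exists_subset_card_eq A (B + 1)
    have h := hsub s
    omega
  refine ⟨inferInstance, ?_⟩
  haveI := Fintype.ofFinite A
  have h := hsub (Finset.univ : Finset A)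
  rwa [Finset.card_univ, ← Nat.card_eq_fintype_card] at h

end Summit.BirchSwinnertonDyer.BirchSwinnertonDyer.Theorems.GoodOrdTower

end
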